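import Summits.CriticalPhenomena.PercolationContinuityZ3.Theses.PercReliabilityThinning

/-!
# Birth skeleton (BC3) for crux `StraightHighways` — line `birth`

Crux (route `PercReliabilityThinning`, item stmt-CriticalPhenomena-11745, FIXED):
`StraightHighways : 0 < θ_{ℤ³}(p_c) → ∃ ρ c, 0 < c ∧ ∀ N ∃ n ≥ N,
  c · P_{p_c}(0 ↔ n e₁) ≤ P_{p_c}(0 ↔ n e₁ ∧ D_ω(0, n e₁) ≤ ρ n)`.

Line (the route header's foreseen split "FiniteChemicalGap → KingmanHighways → StraightHighways",
typed without Palm measures): write `A(ω) = {k ∈ ℕ | k e₁ ∈ C_∞(ω)}` for the axis points of the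
(a.s. unique) infinite cluster, `k₊(ω) = min {k > 0 | k ∈ A(ω)}` (junk `0` if empty) and
`gap(ω) = D_ω(0, k₊(ω) e₁)` for the chemical length of the first axis gap.

* `stub_finiteMeanAxisGap` (the structural heart, open): in a jump world the first axis gap of
  the infinite cluster has finite annealed mean, `E_{p_c}[gap ; 0 ∈ C_∞] < ∞`.
* `stub_axisGapChaining` (Kac chaining, provable now): for every `p` and `n`,
  `E_p[D(0, n e₁) ; 0, n e₁ ∈ C_∞] ≤ n · E_p[gap ; 0 ∈ C_∞]` — on `{0, n ∈ A}` the geodesic is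
  no longer than the chain of gaps through the consecutive points of `A ∩ [0, n]` (uniqueness
  makes consecutive axis points connected a.s.), and each of the `≤ n` gaps has the law of `gap`
  under the `e₁`-shift (stationarity of `P_p`).
* `stub_markovTransfer` (provable now): a linear bound on the two-arm-restricted mean chemical
  distance transfers to the crux — Markov at level `ρ n`, the two-arm lower bound
  `P(0, n e₁ ∈ C_∞) ≥ θ²` (Harris–FKG + translation invariance), a.s. uniqueness
  `{0, n e₁ ∈ C_∞} ⊆ {0 ↔ n e₁}` and `τ ≤ 1`, giving `c = θ²/2`, `ρ = ⌈4C/θ²⌉`, every `n ≥ 1`.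

`StraightHighways_of` composes them (term-mode). Placeholders live only in the three `stub_*`.
-/

namespace Summit.CriticalPhenomena.PercolationContinuityZ3.Cruxes.StraightHighways.Birth

open MeasureTheory
open scoped ENNReal

/-! ## Stub statements (local `Prop` defs; the registered stubs below assert them) -/

/-- **Statement of stub (heart of the line; open, jump-world structure law).** If `θ_{ℤ³}(p_c) > 0` then the
chemical length of the first positive axis gap of the infinite cluster has finite annealed mean:
`∫_{ {0 ∈ C_∞} } D_ω(0, k₊(ω) e₁) dP_{p_c} < ∞`, where
`k₊(ω) = min {k > 0 | k e₁ ∈ C_∞(ω)}` (`sInf`, junk `0`). Why plausible: in a jump world the axis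
points of `C_∞` have density `θ > 0` (mean spacing `1/θ`) and consecutive ones are joined inside
the unique infinite cluster; the bet of card K2 is that these joins are not heavy-tailed.
Why it might fail: BGN forbids slab percolation at `p_c`, so joins may need unbounded detours with
a non-integrable tail even if a positive fraction of them are short. Size: open (L). -/
def FiniteMeanAxisGap : Prop :=
    0 < Literature.Probability.Percolation.theta (Literature.Probability.LatticeModels.zdGraph 3) 0
        (Literature.Probability.Percolation.criticalProbI 3) →
      ∫⁻ ω in Literature.Probability.Percolation.percolatesAt (0 : Fin 3 → ℤ),
          (((Literature.Probability.Percolation.openGraph ω).dist (0 : Fin 3 → ℤ)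
              (Pi.single (0 : Fin 3)
                ((sInf {k : ℕ | 0 < k ∧
                    ω ∈ Literature.Probability.Percolation.percolatesAt
                      (Pi.single (0 : Fin 3) (k : ℤ) : Fin 3 → ℤ)} : ℕ) : ℤ)) : ℕ) : ℝ≥0∞)
        ∂(Literature.Probability.Percolation.bondPercolation
            (Literature.Probability.LatticeModels.zdGraph 3)
            (Literature.Probability.Percolation.criticalProbI 3)) < ⊤

/-- **Statement of stub (Kac chaining along the axis; provable now, M/L).** For every `p` and `n`:
`∫_{ {0, n e₁ ∈ C_∞} } D_ω(0, n e₁) dP_p ≤ n · ∫_{ {0 ∈ C_∞} } D_ω(0, k₊(ω) e₁) dP_p`.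
Pathwise on `{0, n ∈ A}` with `A = {k | k e₁ ∈ C_∞}`: enumerate `A ∩ [0, n]` as
`0 = x₀ < x₁ < ⋯ < x_J = n`; a.s. (uniqueness, `Grimmett1999_numInfiniteClusters_le_one_holds`)
consecutive points are connected, so `D(0, n e₁) ≤ Σ_i D(x_i e₁, x_{i+1} e₁) = Σ_{k < n} 1{k ∈ A}
gap(T^k ω)` (`T` the `e₁`-shift, `BondConfig.relabel (sym2Equiv (Site.shift ·))`); integrate and
use shift invariance of `P_p` (`bondPercolation_real_preimage_shift`) for each of the `n` terms.
Needs measurability of `ω ↦ D_ω(0, x)` and of `k₊`. -/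
def AxisGapChaining : Prop :=
    ∀ (p : unitInterval) (n : ℕ),
      ∫⁻ ω in (Literature.Probability.Percolation.percolatesAt (0 : Fin 3 → ℤ) ∩
          Literature.Probability.Percolation.percolatesAt (Pi.single (0 : Fin 3) (n : ℤ) : Fin 3 → ℤ)),
          (((Literature.Probability.Percolation.openGraph ω).dist (0 : Fin 3 → ℤ)
              (Pi.single (0 : Fin 3) (n : ℤ)) : ℕ) : ℝ≥0∞)
        ∂(Literature.Probability.Percolation.bondPercolation
            (Literature.Probability.LatticeModels.zdGraph 3) p) ≤
      (n : ℝ≥0∞) *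
        ∫⁻ ω in Literature.Probability.Percolation.percolatesAt (0 : Fin 3 → ℤ),
          (((Literature.Probability.Percolation.openGraph ω).dist (0 : Fin 3 → ℤ)
              (Pi.single (0 : Fin 3)
                ((sInf {k : ℕ | 0 < k ∧
                    ω ∈ Literature.Probability.Percolation.percolatesAt
                      (Pi.single (0 : Fin 3) (k : ℤ) : Fin 3 → ℤ)} : ℕ) : ℤ)) : ℕ) : ℝ≥0∞)
        ∂(Literature.Probability.Percolation.bondPercolation
            (Literature.Probability.LatticeModels.zdGraph 3) p)

/-- **Statement of stub (Markov transfer; provable now, M).** A linear bound on the two-arm-restricted mean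
chemical distance along the axis at `p_c` (with a finite constant `C`) yields the crux: for
`n ≥ 1`, Markov gives `P(0, n e₁ ∈ C_∞, D > ρ n) ≤ C/ρ`; Harris–FKG with translation invariance
(`harris_fkg_holds`, `isUpperSet_percolatesAt`, `measurableSet_percolatesAt_holds`,
`theta_zdGraph_eq_theta_zero`) gives `P(0, n e₁ ∈ C_∞) ≥ θ²`; a.s. uniqueness gives
`{0, n e₁ ∈ C_∞} ⊆ {0 ↔ n e₁}` up to a null set (`real_percolatesAt_inter_le_real_openConn`); hence
`P(0 ↔ n e₁, D ≤ ρ n) ≥ θ² − C/ρ ≥ θ²/2 ≥ (θ²/2) · P(0 ↔ n e₁)` for `ρ = ⌈4C/θ²⌉`, all `n ≥ 1`. -/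
def MarkovTransfer : Prop :=
    (0 < Literature.Probability.Percolation.theta (Literature.Probability.LatticeModels.zdGraph 3) 0
        (Literature.Probability.Percolation.criticalProbI 3) →
      ∃ C : ℝ≥0∞, C ≠ ⊤ ∧ ∀ n : ℕ,
        ∫⁻ ω in (Literature.Probability.Percolation.percolatesAt (0 : Fin 3 → ℤ) ∩
            Literature.Probability.Percolation.percolatesAt (Pi.single (0 : Fin 3) (n : ℤ) : Fin 3 → ℤ)),
            (((Literature.Probability.Percolation.openGraph ω).dist (0 : Fin 3 → ℤ)
                (Pi.single (0 : Fin 3) (n : ℤ)) : ℕ) : ℝ≥0∞)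
          ∂(Literature.Probability.Percolation.bondPercolation
              (Literature.Probability.LatticeModels.zdGraph 3)
              (Literature.Probability.Percolation.criticalProbI 3)) ≤ (n : ℝ≥0∞) * C) →
    Summit.CriticalPhenomena.PercolationContinuityZ3.Theses.PercReliabilityThinning.StraightHighways

/-! ## Registered stubs (the ONLY declarations with placeholders) -/

/-- Registered stub 1 (load-bearing, open): see `FiniteMeanAxisGap`. -/
theorem stub_finiteMeanAxisGap : FiniteMeanAxisGap := by
  sorry

/-- Registered stub 2 (provable now): see `AxisGapChaining`. -/
theorem stub_axisGapChaining : AxisGapChaining := by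
  sorry

/-- Registered stub 3 (provable now): see `MarkovTransfer`. -/
theorem stub_markovTransfer : MarkovTransfer := by
  sorry

/-! ### Name-keyed aliases of the stub statements
`__Registered.stub_X` is the statement of stub `stub_X` under the registered stub's short name, so that the
native skeleton audit (`#h21_check_skeleton`: hypotheses admissible iff registered obligations / declared
stubs BY NAME) accepts `StraightHighways_of : __Registered.stub_… → … → StraightHighways` (device of
`Cruxes/BGNOffTheFloor/Lines/birth.lean`; the `@[stub]` attribute is gate-reserved). -/
namespace __Registered

/-- Alias of `FiniteMeanAxisGap` keyed by the registered stub name. -/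
abbrev stub_finiteMeanAxisGap : Prop := FiniteMeanAxisGap
/-- Alias of `AxisGapChaining` keyed by the registered stub name. -/
abbrev stub_axisGapChaining : Prop := AxisGapChaining
/-- Alias of `MarkovTransfer` keyed by the registered stub name. -/
abbrev stub_markovTransfer : Prop := MarkovTransfer

end __Registered

/-! ## Composition -/

/-- **`StraightHighways_of`** (kernel-checked, a real term proof): the three registered stubs give the
crux BY NAME — the finite mean gap (stub 1) and Kac chaining at `p = p_c` (stub 2) produce the linear
two-arm-restricted mean with `C = E_{p_c}[gap ; 0 ∈ C_∞] < ∞`, which the Markov transfer (stub 3)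
turns into `StraightHighways`. -/
theorem StraightHighways_of (h_gap : __Registered.stub_finiteMeanAxisGap)
    (h_chain : __Registered.stub_axisGapChaining) (h_transfer : __Registered.stub_markovTransfer) :
    Summit.CriticalPhenomena.PercolationContinuityZ3.Theses.PercReliabilityThinning.StraightHighways :=
  h_transfer fun hθ =>
    ⟨_, (h_gap hθ).ne, fun n => h_chain (Literature.Probability.Percolation.criticalProbI 3) n⟩

/-- Wiring check: the registered stubs feed `StraightHighways_of` as stated (an `example`, so it is
not a second candidate skeleton theorem). -/
example : Summit.CriticalPhenomena.PercolationContinuityZ3.Theses.PercReliabilityThinning.StraightHighways :=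
  StraightHighways_of stub_finiteMeanAxisGap stub_axisGapChaining stub_markovTransfer

end Summit.CriticalPhenomena.PercolationContinuityZ3.Cruxes.StraightHighways.Birth
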